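import Summits.ResolutionOfSingularities.ResolutionOfSingularities.Theorems.HilbertSamuelEliminationSigmaMaxModificationsCorridor3WLadderStrataBirthsTopRebirthClose
import HarnessLib

/-!
# [OURS · L1 W4.2] (b-end)₃ ROW-J — THE STEP LEMMA: no depth jump at ONE blown-up cycle-end step, from the rebirth dictionary AT THAT
# STEP, no ruled-birth datum AT THAT FRAME, or a one-point near fibre (oracle-free, `IsCanonicalStep`-free, no run quantifier)
# (cell res-hironaka, LADDER-RESOLUTION rung L; slot W4.2, crux chain w42 `SigmaMaxModificationsCorridor3`
# stmt-ResolutionOfSingularities-19249; `--supports stmt-ResolutionOfSingularities-19249 --as helper`; res-L1-w42-plan-1 RULINGS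
# v3.14-8 (CA) 09:50:06Z «RE-CUT to the STEP LEMMA your proof actually is»; hand res-D-brk-3 (gen 5))

res-L1-w42-plan-1 RULINGS v3.14-8 (CA): in skeleton v8.1 no stub asserts «no moving never-isolated W-top chain» for σ_CJS, so the
RUN-LEVEL eventual laws at W-top are FROZEN; in particular `NoRuledBirth3 p` — the `hrec` binder of this seat's run-level ROW-J closer
`strataCycleEndNoDepthJumps_three_of_dictionary` (p520389) — is FALSE-AS-TYPED in the k21 model (res-type-067 audit 2026-08-27T09:38:36Z:
the ruled datum recurs every half-period on the label-oracle walk of `y³ + x₃⁵ + x₁⁶x₂⁶x₃`). What survives, and what res-type-040's Ω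
strata family (the σ-design inside `stub_Wtop_elimination`) re-uses, is the STEP-LOCAL content of that proof, recorded here with NO
oracle, NO `IsCanonicalStep`, NO `∃ n₁`: at ONE step `f : X_{n+1} → X_n` read at the marked points, IF either some centre-adapted CP
frame at `x_n` carries «rebirth event ⇒ ruled-birth datum» (the rebirth dictionary AT THIS STEP, res-type-067's `RebirthDictionary3`
instantiated) together with «no ruled-birth datum» (the no-ruled-birth law AT THIS CYCLE END), OR the near fibre `f⁻¹(x_n) ∩ X_{n+1}(ν)`
is a subsingleton (surface-centre confinement), THEN no irreducible component `Z' ∋ x_{n+1}` of `X_{n+1}(ν)` dominating a component of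
`X_n(ν)` jumps in depth (`HasSandwichAt (c (n+1)) Z' → HasSandwichAt (c n) (closure f(Z'))`). The curve branch is modus tollens; the
surface branch is the binder-free geometry «depth does not jump across a one-point fibre» (`Helpers.exists_sandwich_image_of_fibre_subset`,
p519213, relative Matsumura 15.1 on the stalks). OURS bookkeeping (cell res-hironaka, slot W4.2); NOT a statement of Hironaka's manuscript
[Hironaka2017] nor of [CossartJannsenSaito2020]; no named fact; never a `Theses/…` import; 0 `def`s. AI-written, weaker than expert review.

## What is proved (namespace `…Theorems.SigmaMaxModificationsCorridor3.Moving`)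

* `noDepthJumpAt_of_frameAt` — CURVE branch at one step: a frame datum `(u, h)` with «rebirth event ⇒ `RuledBirthDatumD u h`» and
  `¬ RuledBirthDatumD u h` ⇒ no depth jump at this step (pure logic; the frame's geometry is not even needed).
* `noDepthJumpAt_of_nearFibre_subsingleton` — SURFACE branch at one step: near fibre over `x_n` a subsingleton ⇒ no depth jump
  (geometry, p519213).
* `noDepthJumpAt_of_dichotomyAt` — THE STEP LEMMA (plan-1 (CA)): the disjunction of the two AT THIS STEP ⇒ no depth jump at this step.
* `rebirthDictionaryAt_of_rebirthDictionary3` — how the run-level dictionary `RebirthDictionary3 p` (res-type-067 p518178, a CONTINUING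
  strategy-agnostic local law per (CA)) instantiates the step hypothesis along a chain (so the run-level closer p520389 is literally
  `noDepthJumpAt_of_dichotomyAt` + `NoRuledBirth3`'s stage + `CycleEndCentreDichotomy3`'s case split).

References: tree p517068 (`HasSandwichAt`), p515936 (`RuledBirthDatumD`, `IsCPFrameAlong`), p518178 (`RebirthDictionary3`), p519213,
p520389; HOME STATUS res-L1-w42-plan-1 09:50:06Z (CA), res-type-067 09:38:36Z (k21 audit), res-D-brk-3 09:51:58Z.
-/

noncomputable section

set_option linter.dupNamespace false

open CategoryTheory AlgebraicGeometry TopologicalSpace Topology Polynomial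
open Summit.ResolutionOfSingularities.ResolutionOfSingularities.Theorems.CampaignW42
open Literature.AlgebraicGeometry.Resolution Literature.RingTheory.HilbertSamuel
open Summit.ResolutionOfSingularities.ResolutionOfSingularities.Theorems.SigmaMaxModificationsCorridor3

namespace Summit.ResolutionOfSingularities.ResolutionOfSingularities.Theorems.SigmaMaxModificationsCorridor3.Moving

universe u

variable {ν : ℕ → ℕ}

/-- [OURS · L1 W4.2] **CURVE BRANCH AT ONE STEP (modus tollens).** At a step `f : X_{n+1} → X_n` read at the marked stages `s`, `s'`,
a frame datum `(u, h)` for which the REBIRTH DICTIONARY holds at this step («a depth jump through the chain point hands the frame the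
ruled-birth datum») and which carries NO ruled-birth datum admits no depth jump: every component `Z' ∋ x_{n+1}` of `X_{n+1}(ν)` whose
image closure is a component of `X_n(ν)` and which has a sandwich at `x_{n+1}` has image of depth `≥ 2` at `x_n`. [folklore] -/
theorem noDepthJumpAt_of_frameAt {s s' : MarkedStage.{u}} {f : s'.W ⟶ s.W} {Rf : Type} [CommRing Rf] {u : Fin 3 → Rf} {h : Rf[X]}
    (hdictAt : (∃ Z' ∈ componentsThrough 3 ν s', HasSandwichAt s' Z' ∧
        closure (f.base '' Z') ∈ componentsIn (Scheme.hsStratum s.W 3 ν) ∧ ¬ HasSandwichAt s (closure (f.base '' Z'))) →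
      RuledBirthDatumD u h)
    (hno : ¬ RuledBirthDatumD u h) :
    ∀ Z' ∈ componentsThrough 3 ν s', closure (f.base '' Z') ∈ componentsIn (Scheme.hsStratum s.W 3 ν) →
      HasSandwichAt s' Z' → HasSandwichAt s (closure (f.base '' Z')) := by
  intro Z' hZ' hdom hsw
  by_contra hnot
  exact hno (hdictAt ⟨Z', hZ', hsw, hdom, hnot⟩)

/-- [OURS · L1 W4.2] **SURFACE BRANCH AT ONE STEP (geometry).** At a step `f : X_{n+1} → X_n` with `f x_{n+1} = x_n`, `x_{n+1}` closed in
`X_{n+1}(ν)` (closed), whose NEAR FIBRE over `x_n` — `f⁻¹(x_n) ∩ X_{n+1}(ν)` — is a subsingleton, no component `Z' ∋ x_{n+1}` of `X_{n+1}(ν)`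
jumps in depth: depth does not jump across a one-point fibre (`Helpers.exists_sandwich_image_of_fibre_subset`, p519213; relative
Matsumura 15.1 on the stalks). No dominance hypothesis is needed. [folklore] -/
theorem noDepthJumpAt_of_nearFibre_subsingleton {s s' : MarkedStage.{u}} {f : s'.W ⟶ s.W} (hpt : f.base s'.pt = s.pt)
    (hcl : IsClosed ({s'.pt} : Set s'.W)) (hY' : IsClosed (Scheme.hsStratum s'.W 3 ν)) (hpt' : s'.pt ∈ Scheme.hsStratum s'.W 3 ν)
    (hfib : (f.base ⁻¹' {s.pt} ∩ Scheme.hsStratum s'.W 3 ν).Subsingleton) :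
    ∀ Z' ∈ componentsThrough 3 ν s', HasSandwichAt s' Z' → HasSandwichAt s (closure (f.base '' Z')) := by
  intro Z' hZ' hsw
  refine hasSandwichAt_image_of_fibre_subset hpt hcl (componentsIn.isIrreducible hZ'.1) (componentsIn.isClosed hY' hZ'.1) ?_ hsw
  rintro z ⟨hzZ', hzf⟩
  exact hfib ⟨hzf, componentsIn.subset hZ'.1 hzZ'⟩ ⟨hpt, hpt'⟩

/-- [OURS · L1 W4.2] **THE STEP LEMMA of ROW-J (res-L1-w42-plan-1 RULINGS v3.14-8 (CA)) — NO DEPTH JUMP AT ONE BLOWN-UP CYCLE-END STEP.**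
Data: marked stages `s`, `s'` (the stage `X_n` with its marked point `x_n`, the stage `X_{n+1}` with `x_{n+1}`), a morphism
`f : X_{n+1} → X_n` with `f x_{n+1} = x_n` (the blow-down), `x_{n+1}` closed and in the closed stratum `X_{n+1}(ν)`. Hypothesis AT THIS STEP
(the cycle-end centre dichotomy instantiated, each branch with what the closer consumes there): EITHER some centre `C` admits a CP frame
`(Rf, u, h, φ)` of `x_n` adapted to `C` for which the rebirth dictionary holds at this step and which carries no ruled-birth datum (curve
centre), OR the near fibre of `f` over `x_n` inside `X_{n+1}(ν)` is a subsingleton (surface centre). Conclusion: no component `Z' ∋ x_{n+1}`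
of `X_{n+1}(ν)` dominating a component of `X_n(ν)` jumps in depth. No oracle, no `IsCanonicalStep`, no eventual quantifier — the form Ω
re-uses cycle by cycle. NOT a statement of the manuscript. [folklore] -/
theorem noDepthJumpAt_of_dichotomyAt {s s' : MarkedStage.{u}} {f : s'.W ⟶ s.W} (hpt : f.base s'.pt = s.pt)
    (hcl : IsClosed ({s'.pt} : Set s'.W)) (hY' : IsClosed (Scheme.hsStratum s'.W 3 ν)) (hpt' : s'.pt ∈ Scheme.hsStratum s'.W 3 ν)
    (hdichAt :
      (∃ (C : s.W.IdealSheafData) (Rf : Type) (_ : CommRing Rf) (u : Fin 3 → Rf) (h : Rf[X])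
          (φ : (s.W.presheaf.stalk s.pt : Type u) →+* Rf[X] ⧸ Ideal.span {h}),
          IsCPFrameAlong s C Rf u h φ ∧
            ((∃ Z' ∈ componentsThrough 3 ν s', HasSandwichAt s' Z' ∧
                closure (f.base '' Z') ∈ componentsIn (Scheme.hsStratum s.W 3 ν) ∧ ¬ HasSandwichAt s (closure (f.base '' Z'))) →
              RuledBirthDatumD u h) ∧
            ¬ RuledBirthDatumD u h) ∨
        (f.base ⁻¹' {s.pt} ∩ Scheme.hsStratum s'.W 3 ν).Subsingleton) :
    ∀ Z' ∈ componentsThrough 3 ν s', closure (f.base '' Z') ∈ componentsIn (Scheme.hsStratum s.W 3 ν) →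
      HasSandwichAt s' Z' → HasSandwichAt s (closure (f.base '' Z')) := by
  rcases hdichAt with ⟨C, Rf, _, u, h, φ, -, hdictAt, hno⟩ | hsurf
  · exact noDepthJumpAt_of_frameAt hdictAt hno
  · exact fun Z' hZ' _ hsw => noDepthJumpAt_of_nearFibre_subsingleton hpt hcl hY' hpt' hsurf Z' hZ' hsw

/-- [OURS · L1 W4.2] **The run-level rebirth dictionary instantiates the step hypothesis.** Along a chain of canonical near steps from a
maximal origin, at a blown-up cycle-end step from an `ē = 3` stage, `RebirthDictionary3 p` (res-type-067, p518178 — a CONTINUING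
strategy-agnostic local law per RULINGS v3.14-8 (CA)) yields, for every canonical centre and every centre-adapted CP frame, the «rebirth
event ⇒ ruled-birth datum» clause of `noDepthJumpAt_of_dichotomyAt`. (So p520389's run-level closer = this + the `NoRuledBirth3` stage +
the `CycleEndCentreDichotomy3` case split; only `NoRuledBirth3` is refuted-in-model.) [folklore] -/
theorem rebirthDictionaryAt_of_rebirthDictionary3 {p : ℕ} (hre : RebirthDictionary3.{u} p)
    {R : ∀ S : Scheme.{u}, CentreSeq S → Prop} (hRf : OracleFunctional R) (hRa : OracleAdmissible R)
    {X : Scheme.{u}} [IsLocallyNoetherian X] {x : X} (hX : IsMaximalOrigin p 3 ν X x)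
    {s s' : MarkedStage.{u}} (hs : Reaches R 3 ν (MarkedStage.init X x) s) (hst : CanonicalNearStep R 3 ν s s')
    (hē : s.geomDirDim = 3) (hbu : s.IsBlownUp R 3 ν) (hnone : s'.P = none)
    {C : s.W.IdealSheafData} {P' : Option (Pending (blowup C))} (hcs : IsCanonicalStep R 3 ν s.L s.P C P')
    {f : s'.W ⟶ s.W} (hf : StepProjection R 3 ν s s' f)
    {Rf : Type} [CommRing Rf] {u : Fin 3 → Rf} {h : Rf[X]} {φ : (s.W.presheaf.stalk s.pt : Type u) →+* Rf[X] ⧸ Ideal.span {h}}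
    (hframe : IsCPFrameAlong s C Rf u h φ) :
    (∃ Z' ∈ componentsThrough 3 ν s', HasSandwichAt s' Z' ∧
        closure (f.base '' Z') ∈ componentsIn (Scheme.hsStratum s.W 3 ν) ∧ ¬ HasSandwichAt s (closure (f.base '' Z'))) →
      RuledBirthDatumD u h :=
  fun hev => hre R hRf hRa ν X x hX s s' hs hst hē hbu hnone C P' hcs f hf hev Rf _ u h φ hframe

end Summit.ResolutionOfSingularities.ResolutionOfSingularities.Theorems.SigmaMaxModificationsCorridor3.Moving

end
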